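import Summits.QuantumFields.YangMills.Theorems.ParabolicTrajectoryLatticeGapOnTrajectoryDefs
import Literature.Probability.LatticeModels.DobrushinMetricStates
import Literature.Probability.LatticeModels.ReflectionPositivityExtension
import Summits.QuantumFields.YangMills.Theses.ParabolicTrajectory
import Literature.Probability.LatticeModels.GibbsSpecification
import Literature.MathematicalPhysics.QuantumFieldTheory.YangMillsOS
import Mathlib.Probability.Moments.Covariance

/-!
# Stub `stub_specificationTower` of the line `orbit-kantorovich-finite-size` (crux `LatticeGapOnTrajectory`)

Route `ParabolicTrajectory` of `YangMills`, crux item `stmt-QuantumFields-10523`; the vocabulary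
(`windowAvg`, `SpecificationTower`) is that of `ParabolicTrajectoryLatticeGapOnTrajectoryDefs`.

The multi-site analogue of the one-site toolkit `DobrushinMetric.measurable_siteAvg`,
`DobrushinMetric.abs_siteAvg_le`, `DobrushinMetric.dependsOn_siteAvg` and of
`IsGibbsMeasure.integral_integral_eq` (DLR for observables) of the tree: for a specification `γ`
(Georgii 2011, Def. 1.23) and a bounded measurable `f`, the window average
`(γ_Λ f)(η) = ∫ f dγ_Λ(· | η)` is measurable (Mathlib `StronglyMeasurable.integral_kernel` for the
kernel `γ_Λ` on the full product σ-algebra), bounded by the same bound (the kernels are probability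
measures), depends only on the configuration off `Λ` (it is `𝓕_{Λᶜ}`-measurable for the kernel
`IsSpecification.toKernel`, and `𝓕_{Λᶜ}`-measurable functions factor through the restriction to
`Λᶜ`), pulls out factors depending only on `Λᶜ` (properness `IsSpecification.proper`), and has the
same expectation as `f` under every Gibbs measure (`IsGibbsMeasure.integral_integral_eq`).
-/

namespace Summit.QuantumFields.YangMills.Cruxes.LatticeGapOnTrajectory.OrbitKantorovichFiniteSize

open scoped BigOperators Topology ENNReal ProbabilityTheory
open Filter MeasureTheory
open Literature.Probability.LatticeModels (Specification IsSpecification IsGibbsMeasure glueWith)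
open Literature.MathematicalPhysics.QuantumFieldTheory

noncomputable section

section WindowAvgToolkit

variable {V S : Type*} [MeasurableSpace S] {γ : Specification V S}

/-- `γ_Λ f` is measurable for measurable `f`: `γ_Λ` is a Mathlib kernel on the full product
σ-algebra (`IsSpecification.measurable_fun`) and kernel integrals of strongly measurable functions
are strongly measurable (Mathlib `StronglyMeasurable.integral_kernel`). [folklore] -/
private theorem measurable_windowAvg (hγ : IsSpecification γ) (Λ : Finset V) {f : (V → S) → ℝ}
    (hf : Measurable f) : Measurable (windowAvg γ Λ f) := by
  let κ : ProbabilityTheory.Kernel (V → S) (V → S) := ⟨γ Λ, hγ.measurable_fun Λ⟩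
  exact (hf.stronglyMeasurable.integral_kernel (κ := κ)).measurable

/-- `|γ_Λ f| ≤ B` if `|f| ≤ B` (the kernels are probability measures). [folklore] -/
private theorem abs_windowAvg_le (hγ : IsSpecification γ) (Λ : Finset V) {f : (V → S) → ℝ}
    {B : ℝ} (hB : ∀ σ, |f σ| ≤ B) (η : V → S) : |windowAvg γ Λ f η| ≤ B := by
  haveI := hγ.isProbability Λ η
  have h := norm_integral_le_of_norm_le_const (μ := γ Λ η) (f := f) (C := B)
    (ae_of_all _ fun σ => by rw [Real.norm_eq_abs]; exact hB σ)
  simpa [windowAvg] using h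

/-- `γ_Λ f` depends only on the configuration off `Λ`: it is `𝓕_{Λᶜ}`-measurable (Mathlib
`StronglyMeasurable.integral_kernel` for the kernel `IsSpecification.toKernel` from `𝓕_{Λᶜ}`;
Georgii 2011, Def. 1.23 (ii)), and an `𝓕_{Λᶜ}`-measurable real function factors through the
restriction to `Λᶜ` (`dependsOn_of_measurable_cylinderEvents`). [folklore] -/
private theorem dependsOn_windowAvg (hγ : IsSpecification γ) (Λ : Finset V) {f : (V → S) → ℝ}
    (hf : Measurable f) : DependsOn (windowAvg γ Λ f) ((↑Λ : Set V)ᶜ) := by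
  have hsm : StronglyMeasurable[cylinderEvents (X := fun _ : V => S) ((↑Λ : Set V)ᶜ)]
      (windowAvg γ Λ f) :=
    hf.stronglyMeasurable.integral_kernel (κ := hγ.toKernel Λ)
  exact Literature.Probability.LatticeModels.dependsOn_of_measurable_cylinderEvents hsm.measurable

/-- **Properness, functional form**: a factor `h` depending only on the configuration off `Λ` is
`γ_Λ(· | η)`-a.e. equal to the constant `h η` (`IsSpecification.proper`), so it can be pulled out
of the window average: `γ_Λ (h f) = h · γ_Λ f` (Georgii 2011, Remark 1.20). No integrability is
needed (`integral_congr_ae`, `integral_const_mul`). [folklore] -/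
private theorem windowAvg_mul_of_dependsOn (hγ : IsSpecification γ) (Λ : Finset V)
    (f : (V → S) → ℝ) {h : (V → S) → ℝ} (hdep : DependsOn h ((↑Λ : Set V)ᶜ)) (η : V → S) :
    windowAvg γ Λ (fun σ => h σ * f σ) η = h η * windowAvg γ Λ f η := by
  unfold windowAvg
  rw [← integral_const_mul]
  refine integral_congr_ae ?_
  filter_upwards [hγ.proper Λ η] with σ hσ
  rw [hdep fun i hi => hσ i fun hiΛ => hi (Finset.mem_coe.2 hiΛ)]

/-- **DLR for observables**: `∫ γ_Λ f dν = ∫ f dν` for every Gibbs measure `ν` of `γ` and every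
bounded measurable `f` (`IsGibbsMeasure.integral_integral_eq`; Georgii 2011, Remark 1.24).
[folklore] -/
private theorem integral_windowAvg_eq (hγ : IsSpecification γ) (Λ : Finset V) {f : (V → S) → ℝ}
    (hf : Measurable f) {B : ℝ} (hB : ∀ σ, |f σ| ≤ B) {ν : Measure (V → S)}
    (hν : IsGibbsMeasure γ ν) : ∫ η, windowAvg γ Λ f η ∂ν = ∫ σ, f σ ∂ν := by
  haveI := hν.isProbabilityMeasure
  unfold windowAvg
  exact hν.integral_integral_eq hγ Λ
    (Literature.Probability.LatticeModels.DobrushinMetric.integrable_of_abs_le' hf hB)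

end WindowAvgToolkit

/-- **Window-averaging toolkit of a specification** (`SpecificationTower`): for a specification `γ`
on a finite site set and a bounded measurable `f`, the window average `γ_Λ f` is measurable, bounded
by the same bound, depends only on the configuration off `Λ`, pulls out bounded measurable factors
depending only on `Λᶜ` (properness), and has the same expectation as `f` under every Gibbs measure
(DLR for observables) — the multi-site analogue of the tree's one-site toolkit
(`DobrushinMetric.measurable_siteAvg`, `abs_siteAvg_le`, `dependsOn_siteAvg`,
`IsGibbsMeasure.integral_integral_eq`; Georgii 2011, Def. 1.23, Remarks 1.20 and 1.24). [folklore] -/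
theorem stub_specificationTower : SpecificationTower := by
  intro V S _ _ γ hγ Λ f B hf hB
  exact ⟨measurable_windowAvg hγ Λ hf, fun η => abs_windowAvg_le hγ Λ hB η,
    dependsOn_windowAvg hγ Λ hf, fun _ _ _ hdep η => windowAvg_mul_of_dependsOn hγ Λ f hdep η,
    fun _ hν => integral_windowAvg_eq hγ Λ hf hB hν⟩

end

end Summit.QuantumFields.YangMills.Cruxes.LatticeGapOnTrajectory.OrbitKantorovichFiniteSize
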